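import Summits.Ventures.Crystal3D.Theorems.StickyWulffConstantNoReconstructionGainGrainFrameBudgetTwo
import Summits.Ventures.Crystal3D.Theorems.StickyWulffConstantNoReconstructionGainGrainFrame
import HarnessLib

/-!
# Misoriented grains with at most two substrate contacts per ball gain nothing, at every normal

HONEST FRAMING. Part of the venture `Summits/Ventures/Crystal3D` (cell `crystal3d-full`), helper
`--supports` the crux `NoReconstructionGain` (stmt-Ventures-19144, route
`route-Ventures-StickyWulffConstant`), line `adhesion` (wulff-p1 g11).  The per-ball reduction of
`…GrainFrameLocal` / `…GrainFrame` with a CONTACT CAP `m` in place of `3` (so that a partial cap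
budget can be consumed), and the first UNCONDITIONAL class-(iii) rung of the line:

* `perBall_frameFilm_le_of_le`, `frameFilm_cross_le_of_capBudget_of_le` — as in `…GrainFrameLocal`,
  `…GrainFrame`, for films whose balls touch at most `m` substrate balls, from the cap budget of the frame
  for at most `m` vectors;
* `grainFilm_slab_two` — with the landed budget for two contacts (`frameCapBudget_card_le_two`,
  `…GrainFrameBudgetTwo`): a finite unit packing around the fcc `ν`-slab sample whose film lies above the
  cut, has every film–film contact vector in `A Λ₀` (`A` any linear isometry — e.g. the film is any subset
  of one misoriented fcc grain `A Λ₀ + s`), and whose film balls touch AT MOST TWO substrate balls each,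
  satisfies `#cross(P, X∖P) ≤ D(X∖P)` (`C = 0`), at EVERY unit normal `ν`.

WHAT THIS IS NOT: hollow-site adsorption (three substrate contacts) needs the three-contact budget (open
stub `stub_frameCapBudget`); rung F-C1 not moved.
-/

noncomputable section

namespace Summit.Ventures.Crystal3D.Theorems

open Summit.Ventures.Crystal3D Finset
open Literature.MathematicalPhysics.StatisticalMechanics (fccStacking orderedContacts contactDeficiency)
open scoped InnerProductSpace

/-- **Per-ball reduction to the cap budget, contact cap `m`** (`…GrainFrameLocal` is `m = 3`).  `X` a
finite unit packing, `P ⊆ X` below the cut, the film above the cut and `U`-registered, `q` a film ball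
with at most `m` substrate contacts; `hcap` is the cap budget of the frame `U` for at most `m` vectors.  Conclusion: the per-ball summand of
`frameGain_eq` (frame `U`, `c = √3/2`) plus its rim summand is `≤ 0`. -/
theorem perBall_frameFilm_le_of_le (m : ℕ) (X P : Finset (EuclideanSpace ℝ (Fin 3)))
    (hX : ∀ p ∈ X, ∀ q ∈ X, p ≠ q → 1 ≤ dist p q) (hPX : P ⊆ X)
    (U : Finset (EuclideanSpace ℝ (Fin 3))) (hU1 : ∀ d ∈ U, ‖d‖ = 1)
    (hUsep : ∀ d ∈ U, ∀ d' ∈ U, d ≠ d' → ⟪d, d'⟫_ℝ ≤ 1 / 2)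
    (hcap : ∀ ν : EuclideanSpace ℝ (Fin 3), ‖ν‖ = 1 → ∀ t : ℝ, 0 < t →
      ∀ K : Finset (EuclideanSpace ℝ (Fin 3)), K.card ≤ m →
      (∀ u ∈ K, ‖u‖ = 1 ∧ ⟪u, ν⟫_ℝ ≤ -t) → (∀ u ∈ K, ∀ u' ∈ K, u ≠ u' → ⟪u, u'⟫_ℝ ≤ 1 / 2) →
      (K.card : ℝ) ≤
        ((U.filter fun d => ⟪d, ν⟫_ℝ < 0 ∧ ((∃ u ∈ K, 1 / 2 < ⟪u, d⟫_ℝ) ∨ ⟪d, ν⟫_ℝ ≤ -t)).card : ℝ)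
          + (1 / 2) * ((U.filter fun d => ⟪d, ν⟫_ℝ = 0 ∧ ∃ u ∈ K, 1 / 2 < ⟪u, d⟫_ℝ).card : ℝ))
    (ν : EuclideanSpace ℝ (Fin 3)) (hν : ‖ν‖ = 1) (R : ℝ)
    (hbelow : ∀ p ∈ P, ⟪p, ν⟫_ℝ ≤ -R) (habove : ∀ x ∈ X \ P, -R < ⟪x, ν⟫_ℝ)
    (q : EuclideanSpace ℝ (Fin 3)) (hq : q ∈ X \ P)
    (h3 : (P.filter fun p => dist q p = 1).card ≤ m)
    (hreg : ∀ x ∈ X \ P, dist q x = 1 → x - q ∈ U) :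
    (((P.filter fun p => dist q p = 1 ∧ ∀ d ∈ U, ⟪p - q, d⟫_ℝ ≤ Real.sqrt 3 / 2).card : ℝ)
        + (((X \ P).filter fun x => dist q x = 1 ∧ (∀ d ∈ U, ⟪x - q, d⟫_ℝ ≤ Real.sqrt 3 / 2) ∧
            ⟪x, ν⟫_ℝ < ⟪q, ν⟫_ℝ).card : ℝ)
        + (1 / 2) * (((X \ P).filter fun x => dist q x = 1 ∧ (∀ d ∈ U, ⟪x - q, d⟫_ℝ ≤ Real.sqrt 3 / 2) ∧
            ⟪x, ν⟫_ℝ = ⟪q, ν⟫_ℝ).card : ℝ)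
        - ((U.filter fun d => ⟪d, ν⟫_ℝ < 0 ∧
            ∀ x ∈ X, dist q x = 1 → ⟪x - q, d⟫_ℝ ≤ Real.sqrt 3 / 2).card : ℝ)
        - (1 / 2) * ((U.filter fun d => ⟪d, ν⟫_ℝ = 0 ∧
            ∀ x ∈ X, dist q x = 1 → ⟪x - q, d⟫_ℝ ≤ Real.sqrt 3 / 2).card : ℝ))
      + (((U.filter fun d => 0 < ⟪d, ν⟫_ℝ ∧
            ∃ p ∈ P, dist q p = 1 ∧ Real.sqrt 3 / 2 < ⟪p - q, d⟫_ℝ).card : ℝ)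
        + (1 / 2) * ((U.filter fun d => ⟪d, ν⟫_ℝ = 0 ∧
            ∃ p ∈ P, dist q p = 1 ∧ Real.sqrt 3 / 2 < ⟪p - q, d⟫_ℝ).card : ℝ)) ≤ 0 := by
  classical
  obtain ⟨hc0, hc1, -⟩ := sqrt_three_div_two_bounds
  set c : ℝ := Real.sqrt 3 / 2 with hc
  have hhalf_lt_c : (1 : ℝ) / 2 < c := by
    rw [hc, div_lt_div_iff_of_pos_right (by norm_num : (0:ℝ) < 2)]
    have := Real.lt_sqrt (by norm_num : (0:ℝ) ≤ 1) |>.2 (by norm_num : (1:ℝ) ^ 2 < 3)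
    linarith
  have hUsep' : ∀ d ∈ U, ∀ d' ∈ U, d ≠ d' → ⟪d, d'⟫_ℝ ≤ 2 * c ^ 2 - 1 := by
    intro d hd d' hd' hne; rw [hc, two_mul_sqrt_three_div_two_sq_sub_one]; exact hUsep d hd d' hd' hne
  set NP := P.filter fun p => dist q p = 1 with hNP
  set NF := (X \ P).filter fun x => dist q x = 1 with hNF
  set oP : EuclideanSpace ℝ (Fin 3) → Prop := fun d => ∃ p ∈ NP, c < ⟪p - q, d⟫_ℝ with hoP
  set oF : EuclideanSpace ℝ (Fin 3) → Prop := fun d => ∃ x ∈ NF, c < ⟪x - q, d⟫_ℝ with hoF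
  set vc : EuclideanSpace ℝ (Fin 3) → Prop := fun d => ∀ x ∈ X, dist q x = 1 → ⟪x - q, d⟫_ℝ ≤ c with hvc
  set bl : EuclideanSpace ℝ (Fin 3) → Prop := fun d => ∃ p ∈ NP, 1 / 2 < ⟪p - q, d⟫_ℝ with hbl
  set t : ℝ := ⟪q, ν⟫_ℝ + R with ht
  have hqX : q ∈ X := (mem_sdiff.1 hq).1
  have hqP : q ∉ P := (mem_sdiff.1 hq).2
  have ht0 : 0 < t := by have := habove q hq; rw [ht]; linarith
  have hNPX : ∀ p ∈ NP, p ∈ X ∧ dist q p = 1 := fun p hp =>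
    ⟨hPX (mem_filter.1 hp).1, (mem_filter.1 hp).2⟩
  have hNFX : ∀ x ∈ NF, x ∈ X ∧ dist q x = 1 := fun x hx =>
    ⟨(mem_sdiff.1 (mem_filter.1 hx).1).1, (mem_filter.1 hx).2⟩
  -- (0) no interstitial film contacts
  have hNFint : ∀ x ∈ NF, ¬ (∀ d ∈ U, ⟪x - q, d⟫_ℝ ≤ c) := by
    intro x hx h
    have hxq : x - q ∈ U := hreg x (mem_filter.1 hx).1 (mem_filter.1 hx).2
    have := h (x - q) hxq
    rw [real_inner_self_eq_norm_sq, ← dist_eq_norm, dist_comm, (mem_filter.1 hx).2, one_pow] at this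
    linarith
  have hF1 : (((X \ P).filter fun x => dist q x = 1 ∧ (∀ d ∈ U, ⟪x - q, d⟫_ℝ ≤ c) ∧
      ⟪x, ν⟫_ℝ < ⟪q, ν⟫_ℝ).card : ℝ) = 0 := by
    rw [Nat.cast_eq_zero, card_eq_zero, filter_eq_empty_iff]
    rintro x hx ⟨hqx, hint, -⟩
    exact hNFint x (mem_filter.2 ⟨hx, hqx⟩) hint
  have hF2 : (((X \ P).filter fun x => dist q x = 1 ∧ (∀ d ∈ U, ⟪x - q, d⟫_ℝ ≤ c) ∧
      ⟪x, ν⟫_ℝ = ⟪q, ν⟫_ℝ).card : ℝ) = 0 := by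
    rw [Nat.cast_eq_zero, card_eq_zero, filter_eq_empty_iff]
    rintro x hx ⟨hqx, hint, -⟩
    exact hNFint x (mem_filter.2 ⟨hx, hqx⟩) hint
  -- (1) occupancy states are exclusive; vacancy is the complement
  have hexcl : ∀ d ∈ U, ¬ (oP d ∧ oF d) := by
    rintro d hd ⟨⟨p, hp, hpd⟩, ⟨x, hx, hxd⟩⟩
    have := capPartner_unique X hX (hNPX p hp).1 (hNFX x hx).1 (hNPX p hp).2 (hNFX x hx).2 (hU1 d hd)
      hpd hxd
    exact (mem_sdiff.1 (mem_filter.1 hx).1).2 (this ▸ (mem_filter.1 hp).1)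
  have hvc_iff : ∀ d ∈ U, vc d ↔ ¬ (oP d ∨ oF d) := by
    intro d hd
    constructor
    · rintro h (⟨p, hp, hpd⟩ | ⟨x, hx, hxd⟩)
      · exact absurd (h p (hNPX p hp).1 (hNPX p hp).2) (not_le.2 hpd)
      · exact absurd (h x (hNFX x hx).1 (hNFX x hx).2) (not_le.2 hxd)
    · intro h x hxX hqx
      by_contra hle
      have hlt : c < ⟪x - q, d⟫_ℝ := lt_of_not_ge hle
      by_cases hxP : x ∈ P
      · exact h (Or.inl ⟨x, mem_filter.2 ⟨hxP, hqx⟩, hlt⟩)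
      · exact h (Or.inr ⟨x, mem_filter.2 ⟨mem_sdiff.2 ⟨hxX, hxP⟩, hqx⟩, hlt⟩)
  have hsplit : ∀ S : Finset (EuclideanSpace ℝ (Fin 3)), S ⊆ U →
      (S.card : ℝ) = (S.filter oP).card + (S.filter oF).card + (S.filter vc).card := by
    intro S hS
    have h1 := card_filter_add_card_filter_not (s := S) (fun d => oP d ∨ oF d)
    have h2 : (S.filter fun d => oP d ∨ oF d).card = (S.filter oP).card + (S.filter oF).card := by
      rw [filter_or, card_union_of_disjoint]
      exact disjoint_filter.2 fun d hd h1 h2 => hexcl d (hS hd) ⟨h1, h2⟩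
    have h3 : (S.filter fun d => ¬ (oP d ∨ oF d)) = S.filter vc :=
      filter_congr fun d hd => (hvc_iff d (hS hd)).symm
    rw [h2, h3] at h1
    exact_mod_cast h1.symm
  -- (2) registered substrate contacts ↔ caps occupied by the substrate
  have hregP : ((NP.filter fun p => ∃ d ∈ U, c < ⟪p - q, d⟫_ℝ).card : ℝ) = (U.filter oP).card := by
    have := card_filter_exists_comm NP U (fun p d => c < ⟪p - q, d⟫_ℝ)
      (fun p hp d hd d' hd' h1 h2 => frameDir_unique c le_rfl (hNPX p hp).2 (hU1 d hd) (hU1 d' hd')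
        (fun hne => hUsep' d hd d' hd' hne) h1 h2)
      (fun d hd p hp p' hp' h1 h2 => capPartner_unique X hX (hNPX p hp).1 (hNPX p' hp').1 (hNPX p hp).2
        (hNPX p' hp').2 (hU1 d hd) h1 h2)
    exact_mod_cast this
  have hsplitP : (NP.card : ℝ) = (NP.filter fun p => ∃ d ∈ U, c < ⟪p - q, d⟫_ℝ).card +
      (NP.filter fun p => ∀ d ∈ U, ⟪p - q, d⟫_ℝ ≤ c).card := by
    have h := card_filter_add_card_filter_not (s := NP) (fun p => ∃ d ∈ U, c < ⟪p - q, d⟫_ℝ)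
    have e : (NP.filter fun p => ¬ ∃ d ∈ U, c < ⟪p - q, d⟫_ℝ) = NP.filter fun p => ∀ d ∈ U, ⟪p - q, d⟫_ℝ ≤ c := by
      refine filter_congr fun p _ => ?_
      simp only [not_exists, not_and, not_lt]
    rw [e] at h; exact_mod_cast h.symm
  -- sign classes of `U`
  set Dn := U.filter fun d => ⟪d, ν⟫_ℝ < 0 with hDn
  set Up := U.filter fun d => 0 < ⟪d, ν⟫_ℝ with hUp
  set Lv := U.filter fun d => ⟪d, ν⟫_ℝ = 0 with hLv
  have hDnU : Dn ⊆ U := filter_subset _ _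
  have hLvU : Lv ⊆ U := filter_subset _ _
  have hUsplit : ∀ (Rr : EuclideanSpace ℝ (Fin 3) → Prop) [DecidablePred Rr],
      ((U.filter Rr).card : ℝ) = (Dn.filter Rr).card + (Up.filter Rr).card + (Lv.filter Rr).card := by
    intro Rr _
    have h1 := card_filter_add_card_filter_not (s := U.filter Rr) (fun d => ⟪d, ν⟫_ℝ < 0)
    have h2 := card_filter_add_card_filter_not (s := (U.filter Rr).filter fun d => ¬ ⟪d, ν⟫_ℝ < 0)
      (fun d => 0 < ⟪d, ν⟫_ℝ)
    have e1 : (U.filter Rr).filter (fun d => ⟪d, ν⟫_ℝ < 0) = Dn.filter Rr := by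
      ext d; simp only [hDn, mem_filter]
      constructor
      · rintro ⟨⟨h1, h2⟩, h3⟩; exact ⟨⟨h1, h3⟩, h2⟩
      · rintro ⟨⟨h1, h3⟩, h2⟩; exact ⟨⟨h1, h2⟩, h3⟩
    have e2 : ((U.filter Rr).filter fun d => ¬ ⟪d, ν⟫_ℝ < 0).filter (fun d => 0 < ⟪d, ν⟫_ℝ) = Up.filter Rr := by
      ext d; simp only [hUp, mem_filter]
      constructor
      · rintro ⟨⟨⟨h1, h2⟩, _⟩, h4⟩; exact ⟨⟨h1, h4⟩, h2⟩
      · rintro ⟨⟨h1, h4⟩, h2⟩; exact ⟨⟨⟨h1, h2⟩, not_lt.2 h4.le⟩, h4⟩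
    have e3 : ((U.filter Rr).filter fun d => ¬ ⟪d, ν⟫_ℝ < 0).filter (fun d => ¬ 0 < ⟪d, ν⟫_ℝ) = Lv.filter Rr := by
      ext d; simp only [hLv, mem_filter]
      constructor
      · rintro ⟨⟨⟨h1, h2⟩, h3⟩, h4⟩; exact ⟨⟨h1, le_antisymm (not_lt.1 h4) (not_lt.1 h3)⟩, h2⟩
      · rintro ⟨⟨h1, h4⟩, h2⟩; exact ⟨⟨⟨h1, h2⟩, by rw [h4]; exact lt_irrefl 0⟩, by rw [h4]; exact lt_irrefl 0⟩
    rw [e1] at h1; rw [e2, e3] at h2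
    have h1' : ((U.filter Rr).card : ℝ) = (Dn.filter Rr).card + (((U.filter Rr).filter fun d => ¬ ⟪d, ν⟫_ℝ < 0).card : ℝ) := by
      exact_mod_cast h1.symm
    have h2' : ((((U.filter Rr).filter fun d => ¬ ⟪d, ν⟫_ℝ < 0).card : ℕ) : ℝ) = (Up.filter Rr).card + (Lv.filter Rr).card := by
      exact_mod_cast h2.symm
    rw [h1', h2']; ring
  -- (3) a film-occupied cap `d` is exactly the slot `q + d`, which is neither steep nor blocked
  have hoF_slot : ∀ d ∈ U, oF d → q + d ∈ X \ P := by
    rintro d hd ⟨x, hx, hxd⟩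
    have hxq : x - q ∈ U := hreg x (mem_filter.1 hx).1 (mem_filter.1 hx).2
    have := eq_add_of_registered hUsep hxq hd hxd
    rw [← this]; exact (mem_filter.1 hx).1
  have hoF_not_steep : ∀ d ∈ U, oF d → ¬ ⟪d, ν⟫_ℝ ≤ -t := by
    intro d hd hoFd hst
    have hslot := hoF_slot d hd hoFd
    have h1 := habove (q + d) hslot
    rw [inner_add_left] at h1
    rw [ht] at hst
    linarith
  have hoF_not_bl : ∀ d ∈ U, oF d → ¬ bl d := by
    rintro d hd hoFd ⟨p, hp, hpd⟩
    have hslot := hoF_slot d hd hoFd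
    have hpP : p ∈ P := (mem_filter.1 hp).1
    have hne : p ≠ q + d := fun h => (mem_sdiff.1 hslot).2 (h ▸ hpP)
    have h1 := hX p (hPX hpP) (q + d) (mem_sdiff.1 hslot).1 hne
    have hu : ‖p - q‖ = 1 := by rw [← dist_eq_norm, dist_comm, (hNPX p hp).2]
    have hsq : dist p (q + d) ^ 2 < 1 := by
      rw [dist_eq_norm, show p - (q + d) = (p - q) - d by abel, norm_sub_sq_real, hu, hU1 d hd]
      linarith
    nlinarith [dist_nonneg (x := p) (y := q + d)]
  -- (4) the cap budget applied to the substrate contacts of `q`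
  set K := NP.image fun p => p - q with hK
  have hKcard : K.card = NP.card := card_image_of_injective _ sub_left_injective
  have hKmem : ∀ u ∈ K, ∃ p ∈ NP, p - q = u := fun u hu => by
    simpa only [hK, mem_image] using hu
  have hK1 : ∀ u ∈ K, ‖u‖ = 1 ∧ ⟪u, ν⟫_ℝ ≤ -t := by
    intro u hu
    obtain ⟨p, hp, rfl⟩ := hKmem u hu
    refine ⟨by rw [← dist_eq_norm, dist_comm, (hNPX p hp).2], ?_⟩
    rw [inner_sub_left, ht]
    have := hbelow p (mem_filter.1 hp).1
    linarith
  have hK2 : ∀ u ∈ K, ∀ u' ∈ K, u ≠ u' → ⟪u, u'⟫_ℝ ≤ 1 / 2 := by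
    intro u hu u' hu' hne
    obtain ⟨p, hp, rfl⟩ := hKmem u hu
    obtain ⟨p', hp', rfl⟩ := hKmem u' hu'
    have hpp' : p ≠ p' := fun h => hne (by rw [h])
    exact real_inner_sub_le_half_of_dist (hNPX p hp).2 (hNPX p' hp').2
      (hX p (hNPX p hp).1 p' (hNPX p' hp').1 hpp')
  have hK3 : K.card ≤ m := by rw [hKcard]; exact h3
  have hbudget := hcap ν hν t ht0 K hK3 hK1 hK2
  have hblK : ∀ d, (∃ u ∈ K, 1 / 2 < ⟪u, d⟫_ℝ) ↔ bl d := by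
    intro d
    constructor
    · rintro ⟨u, hu, hud⟩
      obtain ⟨p, hp, rfl⟩ := hKmem u hu
      exact ⟨p, hp, hud⟩
    · rintro ⟨p, hp, hpd⟩
      exact ⟨p - q, mem_image.2 ⟨p, hp, rfl⟩, hpd⟩
  have hB1 : (U.filter fun d => ⟪d, ν⟫_ℝ < 0 ∧ ((∃ u ∈ K, 1 / 2 < ⟪u, d⟫_ℝ) ∨ ⟪d, ν⟫_ℝ ≤ -t)) =
      Dn.filter fun d => bl d ∨ ⟪d, ν⟫_ℝ ≤ -t := by
    rw [hDn, filter_filter]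
    exact filter_congr fun d _ => and_congr Iff.rfl (or_congr (hblK d) Iff.rfl)
  have hB2 : (U.filter fun d => ⟪d, ν⟫_ℝ = 0 ∧ ∃ u ∈ K, 1 / 2 < ⟪u, d⟫_ℝ) = Lv.filter bl := by
    rw [hLv, filter_filter]
    exact filter_congr fun d _ => and_congr Iff.rfl (hblK d)
  rw [hB1, hB2, hKcard] at hbudget
  -- (5) the film-occupied down / level caps miss the steep-or-blocked / blocked ones
  have hoF_Dn : ((Dn.filter oF).card : ℝ) + (Dn.filter fun d => bl d ∨ ⟪d, ν⟫_ℝ ≤ -t).card ≤ Dn.card := by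
    have h := card_union_of_disjoint (disjoint_filter.2 fun d hd (h1 : oF d) (h2 : bl d ∨ ⟪d, ν⟫_ℝ ≤ -t) =>
      h2.elim (hoF_not_bl d (hDnU hd) h1) (hoF_not_steep d (hDnU hd) h1))
    have h' := card_le_card (union_subset (filter_subset oF Dn)
      (filter_subset (fun d => bl d ∨ ⟪d, ν⟫_ℝ ≤ -t) Dn))
    rw [h] at h'
    exact_mod_cast h'
  have hoF_Lv : ((Lv.filter oF).card : ℝ) + (Lv.filter bl).card ≤ Lv.card := by
    have h := card_union_of_disjoint (disjoint_filter.2 fun d hd (h1 : oF d) (h2 : bl d) =>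
      hoF_not_bl d (hLvU hd) h1 h2)
    have h' := card_le_card (union_subset (filter_subset oF Lv) (filter_subset bl Lv))
    rw [h] at h'
    exact_mod_cast h'
  -- (6) rewrite the statement's filters
  have r1 : (P.filter fun p => dist q p = 1 ∧ ∀ d ∈ U, ⟪p - q, d⟫_ℝ ≤ c) =
      NP.filter fun p => ∀ d ∈ U, ⟪p - q, d⟫_ℝ ≤ c := by rw [hNP, filter_filter]
  have hvD : (U.filter fun d => ⟪d, ν⟫_ℝ < 0 ∧ ∀ x ∈ X, dist q x = 1 → ⟪x - q, d⟫_ℝ ≤ c) = Dn.filter vc := by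
    rw [hDn, filter_filter]
  have hvL : (U.filter fun d => ⟪d, ν⟫_ℝ = 0 ∧ ∀ x ∈ X, dist q x = 1 → ⟪x - q, d⟫_ℝ ≤ c) = Lv.filter vc := by
    rw [hLv, filter_filter]
  have r5 : (U.filter fun d => 0 < ⟪d, ν⟫_ℝ ∧ ∃ p ∈ P, dist q p = 1 ∧ c < ⟪p - q, d⟫_ℝ) = Up.filter oP := by
    rw [hUp, filter_filter]
    refine filter_congr fun d _ => and_congr Iff.rfl ?_
    simp only [hoP, hNP, mem_filter, and_assoc]
  have r6 : (U.filter fun d => ⟪d, ν⟫_ℝ = 0 ∧ ∃ p ∈ P, dist q p = 1 ∧ c < ⟪p - q, d⟫_ℝ) = Lv.filter oP := by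
    rw [hLv, filter_filter]
    refine filter_congr fun d _ => and_congr Iff.rfl ?_
    simp only [hoP, hNP, mem_filter, and_assoc]
  rw [r1, hF1, hF2, hvD, hvL, r5, r6]
  have sDn := hsplit Dn hDnU
  have sLv := hsplit Lv hLvU
  have pP := hUsplit oP
  rw [hregP] at hsplitP
  have hnn : (0 : ℝ) ≤ ((Lv.filter oP).card : ℝ) := Nat.cast_nonneg _
  have hnn2 : (0 : ℝ) ≤ ((Dn.filter oP).card : ℝ) := Nat.cast_nonneg _
  linarith [sDn, sLv, pP, hsplitP, hbudget, hoF_Dn, hoF_Lv]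

/-- **Frame-registered films gain nothing, given the cap budget of the frame up to the contact cap `m`.**
(`…GrainFrame` is `m = 3`.)  Each film ball touches at most `m` substrate balls and the cap budget is
assumed for at most `m` vectors.  Then `#cross(P, X∖P) ≤ D(X∖P)`. -/
theorem frameFilm_cross_le_of_capBudget_of_le (m : ℕ) (X P : Finset (EuclideanSpace ℝ (Fin 3)))
    (hX : ∀ p ∈ X, ∀ q ∈ X, p ≠ q → 1 ≤ dist p q) (hPX : P ⊆ X)
    (U : Finset (EuclideanSpace ℝ (Fin 3))) (hU1 : ∀ d ∈ U, ‖d‖ = 1)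
    (hUsep : ∀ d ∈ U, ∀ d' ∈ U, d ≠ d' → ⟪d, d'⟫_ℝ ≤ 1 / 2) (hUneg : ∀ d ∈ U, -d ∈ U)
    (hUcard : U.card = 12)
    (hcap : ∀ ν : EuclideanSpace ℝ (Fin 3), ‖ν‖ = 1 → ∀ t : ℝ, 0 < t →
      ∀ K : Finset (EuclideanSpace ℝ (Fin 3)), K.card ≤ m →
      (∀ u ∈ K, ‖u‖ = 1 ∧ ⟪u, ν⟫_ℝ ≤ -t) → (∀ u ∈ K, ∀ u' ∈ K, u ≠ u' → ⟪u, u'⟫_ℝ ≤ 1 / 2) →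
      (K.card : ℝ) ≤
        ((U.filter fun d => ⟪d, ν⟫_ℝ < 0 ∧ ((∃ u ∈ K, 1 / 2 < ⟪u, d⟫_ℝ) ∨ ⟪d, ν⟫_ℝ ≤ -t)).card : ℝ)
          + (1 / 2) * ((U.filter fun d => ⟪d, ν⟫_ℝ = 0 ∧ ∃ u ∈ K, 1 / 2 < ⟪u, d⟫_ℝ).card : ℝ))
    (ν : EuclideanSpace ℝ (Fin 3)) (hν : ‖ν‖ = 1) (R : ℝ)
    (hbelow : ∀ p ∈ P, ⟪p, ν⟫_ℝ ≤ -R) (habove : ∀ x ∈ X \ P, -R < ⟪x, ν⟫_ℝ)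
    (h3 : ∀ q ∈ X \ P, (P.filter fun p => dist q p = 1).card ≤ m)
    (hreg : ∀ q ∈ X \ P, ∀ x ∈ X \ P, dist q x = 1 → x - q ∈ U) :
    ((((P ×ˢ (X \ P)).filter fun pq => dist pq.1 pq.2 = 1).card : ℕ) : ℝ) ≤
      contactDeficiency (X \ P) := by
  classical
  have hc3 : Real.sqrt 3 / 2 ≤ Real.sqrt 3 / 2 := le_rfl
  have hUsep' : ∀ d ∈ U, ∀ d' ∈ U, d ≠ d' → ⟪d, d'⟫_ℝ ≤ 2 * (Real.sqrt 3 / 2) ^ 2 - 1 := by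
    intro d hd d' hd' hne; rw [two_mul_sqrt_three_div_two_sq_sub_one]; exact hUsep d hd d' hd' hne
  rw [frameGain_eq X P hX hPX U (Real.sqrt 3 / 2) hc3 hU1 hUsep' hUneg ν, hUcard]
  have hmid : (((12 : ℕ) : ℝ) - 12) / 2 * ((X \ P).card : ℝ) = 0 := by norm_num
  rw [hmid, add_zero, add_assoc, ← sum_add_distrib]
  have hsum := sum_nonpos fun q hq =>
    perBall_frameFilm_le_of_le m X P hX hPX U hU1 hUsep hcap ν hν R hbelow habove q hq (h3 q hq) (hreg q hq)
  linarith

/-- **RUNG (unconditional; class (iii)): misoriented-grain films each of whose balls touches at most TWO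
substrate balls gain nothing, at every normal** (`R = 1`, `C = 0`).  `U₀` is any twelve-element set of
unit vectors of `Λ₀` closed under negation, `A` any linear isometry; every finite unit packing around the
`ν`-slab sample whose film lies above the cut with every film–film contact vector in `A Λ₀` (e.g. any
subset of one moved lattice `A Λ₀ + s`) and whose film balls touch at most two substrate balls each
satisfies `#cross(P, X∖P) ≤ D(X∖P) + C ρ` — by the cap budget for two contacts
(`frameCapBudget_card_le_two`). -/
theorem grainFilm_slab_two :
    ∃ R C : ℝ, 1 ≤ R ∧ ∀ U₀ : Finset (EuclideanSpace ℝ (Fin 3)),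
      (∀ d ∈ U₀, d ∈ fccStacking 1 (Real.sqrt (2 / 3)) ∧ ‖d‖ = 1) → (∀ d ∈ U₀, -d ∈ U₀) → U₀.card = 12 →
      ∀ A : EuclideanSpace ℝ (Fin 3) ≃ₗᵢ[ℝ] EuclideanSpace ℝ (Fin 3),
      ∀ ν : EuclideanSpace ℝ (Fin 3), ‖ν‖ = 1 → ∀ ρ : ℝ, R ≤ ρ →
      ∀ X P : Finset (EuclideanSpace ℝ (Fin 3)),
      (∀ p ∈ X, ∀ q ∈ X, p ≠ q → 1 ≤ dist p q) → P ⊆ X →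
      (∀ p, p ∈ P ↔ (p ∈ fccStacking 1 (Real.sqrt (2 / 3)) ∧ -(2 * R) ≤ ⟪p, ν⟫_ℝ ∧
        ⟪p, ν⟫_ℝ ≤ -R ∧ ‖p‖ ^ 2 - ⟪p, ν⟫_ℝ ^ 2 ≤ ρ ^ 2)) →
      (∀ q ∈ X \ P, -R < ⟪q, ν⟫_ℝ) →
      (∀ q ∈ X \ P, (P.filter fun p => dist q p = 1).card ≤ 2) →
      (∀ q ∈ X \ P, ∀ x ∈ X \ P, dist q x = 1 → A.symm (x - q) ∈ fccStacking 1 (Real.sqrt (2 / 3))) →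
      ((((P ×ˢ (X \ P)).filter fun pq => dist pq.1 pq.2 = 1).card : ℕ) : ℝ) ≤
        contactDeficiency (X \ P) + C * ρ := by
  classical
  refine ⟨1, 0, le_rfl, ?_⟩
  intro U₀ hU₀ hU₀neg hU₀card A ν hν ρ hρ X P hX hPX hP habove h2 hreg
  rw [zero_mul, add_zero]
  set U := U₀.image fun d => A d with hU
  have hAinj : Function.Injective fun d : EuclideanSpace ℝ (Fin 3) => A d := A.injective
  have hUmem : ∀ d ∈ U, ∃ d₀ ∈ U₀, A d₀ = d := fun d hd => by simpa only [hU, mem_image] using hd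
  have hU1 : ∀ d ∈ U, ‖d‖ = 1 := by
    intro d hd
    obtain ⟨d₀, hd₀, rfl⟩ := hUmem d hd
    rw [LinearIsometryEquiv.norm_map]; exact (hU₀ d₀ hd₀).2
  have hUsep : ∀ d ∈ U, ∀ d' ∈ U, d ≠ d' → ⟪d, d'⟫_ℝ ≤ 1 / 2 := by
    intro d hd d' hd' hne
    obtain ⟨d₀, hd₀, rfl⟩ := hUmem d hd
    obtain ⟨d₀', hd₀', rfl⟩ := hUmem d' hd'
    rw [LinearIsometryEquiv.inner_map_map]
    exact real_inner_le_half_of_fcc_unit (hU₀ d₀ hd₀).1 (hU₀ d₀' hd₀').1 (hU₀ d₀ hd₀).2 (hU₀ d₀' hd₀').2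
      (fun h => hne (by rw [h]))
  have hUneg : ∀ d ∈ U, -d ∈ U := by
    intro d hd
    obtain ⟨d₀, hd₀, rfl⟩ := hUmem d hd
    exact mem_image.2 ⟨-d₀, hU₀neg d₀ hd₀, by simp⟩
  have hUcard : U.card = 12 := by rw [hU, card_image_of_injective _ hAinj, hU₀card]
  have hbelow : ∀ p ∈ P, ⟪p, ν⟫_ℝ ≤ -(1 : ℝ) := fun p hp => ((hP p).1 hp).2.2.1
  have hreg' : ∀ q ∈ X \ P, ∀ x ∈ X \ P, dist q x = 1 → x - q ∈ U := by
    intro q hq x hx hqx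
    have hmem := hreg q hq x hx hqx
    have hnorm : ‖A.symm (x - q)‖ = 1 := by
      rw [LinearIsometryEquiv.norm_map, ← dist_eq_norm, dist_comm, hqx]
    have h0 := fcc_unit_mem_of_bondStar U₀ hU₀ hU₀card hmem hnorm
    exact mem_image.2 ⟨A.symm (x - q), h0, by simp⟩
  have hcap := fun (ν' : EuclideanSpace ℝ (Fin 3)) (hν' : ‖ν'‖ = 1) (t : ℝ) (ht : 0 < t)
      (K : Finset (EuclideanSpace ℝ (Fin 3))) (hK : K.card ≤ 2)
      (hK1 : ∀ u ∈ K, ‖u‖ = 1 ∧ ⟪u, ν'⟫_ℝ ≤ -t)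
      (hK2 : ∀ u ∈ K, ∀ u' ∈ K, u ≠ u' → ⟪u, u'⟫_ℝ ≤ 1 / 2) =>
    frameCapBudget_card_le_two U₀ hU₀ hU₀neg hU₀card A ν' hν' t ht K hK hK1 hK2
  exact frameFilm_cross_le_of_capBudget_of_le 2 X P hX hPX U hU1 hUsep hUneg hUcard hcap ν hν 1 hbelow
    habove h2 hreg'

end Summit.Ventures.Crystal3D.Theorems

end
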